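import Summits.NavierStokesRegularity.NavierStokesRegularity.Theorems.TaoLadderRungTwoFlatCoMovingEnergyWindow
import Summits.NavierStokesRegularity.NavierStokesRegularity.Theorems.TaoLadderRungTwoFlatComovingPulse
import Summits.NavierStokesRegularity.NavierStokesRegularity.Theorems.TaoLadderRungTwoFlatHopTubeLanding
import Summits.NavierStokesRegularity.NavierStokesRegularity.Theorems.TaoLadderRungTwoFlatJunkAmplitude
import HarnessLib

/-!
# The NEAR-ZONE HOP along exact graded window flows: `TubeStepNear`'s landing inequality from the co-moving
  energy decay (helper for the K_A♭ parent item stmt-NavierStokesRegularity-22987 `FlatGapCertificatesV2`, child 2A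
  `GradedAdiabaticWakeA` of route TaoLadderRungTwoFlat; cell harvest/h2-tao-ladder, p1 g22; LADDER §49–§52,
  `HopTube.TubeStepNear`)

WHAT THIS FILE PROVES (kernel, no `sorry`). The per-hop NEAR-BEHIND obligation of the typed induction frame `H(n)`
(`HopTube.TubeStepNear n`: the re-centred landing state `S(1+·, τ₁)/a` has co-moving block deviation energy
`≤ v(n+1)`) is reduced to the tree's co-moving energy inequality along two EXACT graded certificate flows
(`MirrorPulse.coMovingEnergyOn_decay_of_pseudoFlows`, L8b-1): the hop flow `S` (from the kicked tube state) and a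
reference flow `W` (the pulse-family member the tube state shadows), both `PseudoFlowOnShift S♭ τ ε₀ T♭(ε) 0 …` on the
certificate window. The block is FIXED in absolute shells, `[1−D, −K]` (= the near block `[−D, −K−1]` of `H(n+1)` read
at the landing sites `1+k`), the co-moving edge advances exactly one shell over the hop (`n_e(t) = −K + σt`, `στ₁ = 1`),
and the clocks on the block are `≤ 1` (`k ≤ −K ≤ 0`, `ε₀ ≥ 0`).

* `coMovingEnergyOn_eq_nearSum`, `coMovingEnergyOn_Icc_shift` — the frame's near functional IS a co-moving block
  energy (edge at `−K`), and the landing block is the shifted one;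
* `sqrt_coMovingEnergyOn_add_le` — Minkowski for the weighted block energy (amplitude variable `√V`, the variable of
  the 2×2 loop `TwoZoneLoop`);
* `near_landing_of_energies` — LANDING: `√V_{[1−D,−K]}(S − W)(τ₁) ≤ √V₁`, template landing residual
  `√(Σ e^{θ(k+K)} ½|W(1+k, τ₁) − x′u⋆(k)|²) ≤ √R_T` (`x′ = |S i₀ 1 τ₁|/A_*` the landing carrier's own scale) and the budget
  `(√V₁ + √R_T)² ≤ a²v(n+1)` give `NearClause (n+1) (recentre S τ₁ a)` (via `HopTube.nearClause_recentre`);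
* `near_hop_of_pseudoFlows` — THE HOP: the a-priori amplitude / template / edge-input bounds of the decay lemma on
  `(0, τ₁)`, a rate `0 < μ ≤ σθ_V − 2(1+ε)(A sinh(θ_V/2) + M(3+e^{θ_V}))`, an initial bound `V(0) ≤ V₀` and the budget
  `(√(e^{−μτ₁}V₀ + Ē(1−e^{−μτ₁})/μ) + √R_T)² ≤ a²v(n+1)` give the near clause of `H(n+1)`;
* `near_hop_of_globalSols` — the FLAT twin (`ε₀ = 0`, two global solutions; child 1A's flat tube, A52-1) with the
  tree's `coMovingEnergyOn_decay_of_globalSol`; `templateResidual_of_shift_landing` — for an exact shift landing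
  `W(1+k, τ₁) = x·u⋆(k)` the residual is `(x − x′)²·Σ e^{θ(k+K)} ½|u⋆(k)|²` (anchor-scale drift, a core-zone output);
* (part 2, module `…NearHopStart`) `sqrt_initial_coMovingEnergyOn_le` — THE START: `√V(0) ≤ √v(n) + δ(n)/ω_K +
  √D·r_k + √E_W` from `NearClause n z`, the core clause at the window bottom `−K`, the kick on the block and the reference
  start residual (so `V₀` is a schedule expression: the `m₁₁`/`m₁₂` entries of the two-zone loop).

What is NOT proved here (the remaining inputs of `TubeStepNear n`, each a named hypothesis above): the a-priori bounds
`A, M` during the hop (core lane: gauge Grönwall `QuadPolar.gauge_abs_sub_le_Icc` + far-behind envelope), the edge-input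
bound `Ē` (tree `MirrorPulse.edgeInput_le` from the core deviation above `−K` and the behind amplitude below `−D`), and the
template landing residual `R_T` (a property of the reference flow alone: flat pulse = shift-periodicity, graded = §50.7 (C)).

HONEST FRAMING: inequalities about MODEL-lattice certificate flows (Tao 2016 §4 vocabulary, graded mirror table on `S♭`);
every bound is a HYPOTHESIS; nothing is certified about any orbit; no item is closed; nothing here is a statement about
the Navier–Stokes equations.
-/

noncomputable section

-- the sub-problem namespace repeats the summit name by design (D-0017)
set_option linter.dupNamespace false

namespace Summit.NavierStokesRegularity.NavierStokesRegularity.Theorems.HopTube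

open Set Finset Literature.Analysis.FluidPDE Literature.Analysis.FluidPDE.TaoCascade MirrorPulse

/-! ## The near functional as a co-moving block energy -/

/-- With the edge at the window bottom `n_e = −K`, the co-moving block energy of a family `u` at time `t` is the
frame's near-behind functional `Σ_{k∈s} e^{θ(k+K)}·Σ_i ½ u_{i,k}(t)²`.
[cite: Tao2016AveragedNS, §4 (4.3); route TaoLadderRungTwoFlat, L8b functional vs `HopTube.NearClause` (LADDER §49, §50)] -/
theorem coMovingEnergyOn_eq_nearSum (s : Finset ℤ) (θ : ℝ) (K : ℕ) (u : Fin 2 → ℤ → ℝ → ℝ) (t : ℝ) :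
    coMovingEnergyOn s θ (-(K : ℝ)) u t
      = ∑ k ∈ s, Real.exp (θ * ((k : ℝ) + K)) * ∑ i : Fin 2, u i k t ^ 2 / 2 := by
  unfold coMovingEnergyOn
  refine Finset.sum_congr rfl fun k _ => ?_
  rw [Fin.sum_univ_two, sub_neg_eq_add]
  ring

/-- Shifting the block and the edge together is re-indexing the family: `V_{[a+c,b+c]}^{n_e+c}(u) =
V_{[a,b]}^{n_e}(u(·+c))`. [cite: Tao2016AveragedNS, §4 (4.3); route TaoLadderRungTwoFlat, L8b (re-centring by one shell per hop)] -/
theorem coMovingEnergyOn_Icc_shift (a b c : ℤ) (θ ne : ℝ) (u : Fin 2 → ℤ → ℝ → ℝ) (t : ℝ) :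
    coMovingEnergyOn (Finset.Icc (a + c) (b + c)) θ (ne + c) u t
      = coMovingEnergyOn (Finset.Icc a b) θ ne (fun i k s => u i (k + c) s) t := by
  unfold coMovingEnergyOn
  rw [← MirrorPulse.sum_Icc_add_shift]
  refine Finset.sum_congr rfl fun k _ => ?_
  simp only [Int.cast_add]
  ring_nf

/-- The co-moving block energy depends on the family only through its values at the evaluation time.
[cite: Tao2016AveragedNS, §4 (4.3); route TaoLadderRungTwoFlat, L8b] -/
theorem coMovingEnergyOn_congr_at {s : Finset ℤ} {θ ne t : ℝ} {u v : Fin 2 → ℤ → ℝ → ℝ}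
    (h : ∀ i, ∀ k ∈ s, u i k t = v i k t) :
    coMovingEnergyOn s θ ne u t = coMovingEnergyOn s θ ne v t := by
  unfold coMovingEnergyOn
  refine Finset.sum_congr rfl fun k hk => ?_
  rw [h 0 k hk, h 1 k hk]

/-- **MINKOWSKI for the weighted block energy**: `√V(u+v) ≤ √V(u) + √V(v)` (the amplitude `√V` is the variable of the
two-zone loop). [folklore (Minkowski / Cauchy–Schwarz); route TaoLadderRungTwoFlat, L8b-4 amplitude variables] -/
theorem sqrt_coMovingEnergyOn_add_le (s : Finset ℤ) (θ ne : ℝ) (u v : Fin 2 → ℤ → ℝ → ℝ) (t : ℝ) :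
    Real.sqrt (coMovingEnergyOn s θ ne (u + v) t)
      ≤ Real.sqrt (coMovingEnergyOn s θ ne u t) + Real.sqrt (coMovingEnergyOn s θ ne v t) := by
  have key : ∀ f : Fin 2 → ℤ → ℝ → ℝ, coMovingEnergyOn s θ ne f t =
      ∑ p ∈ s ×ˢ (Finset.univ : Finset (Fin 2)),
        (Real.sqrt (Real.exp (θ * ((p.1 : ℝ) - ne)) / 2) * f p.2 p.1 t) ^ 2 := by
    intro f
    unfold coMovingEnergyOn
    rw [Finset.sum_product]
    refine Finset.sum_congr rfl fun k _ => ?_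
    rw [Fin.sum_univ_two]
    have h0 : 0 ≤ Real.exp (θ * ((k : ℝ) - ne)) / 2 := by positivity
    rw [mul_pow, mul_pow, Real.sq_sqrt h0]
    ring
  rw [key (u + v), key u, key v]
  have e : ∀ p : ℤ × Fin 2, Real.sqrt (Real.exp (θ * ((p.1 : ℝ) - ne)) / 2) * (u + v) p.2 p.1 t
      = Real.sqrt (Real.exp (θ * ((p.1 : ℝ) - ne)) / 2) * u p.2 p.1 t
        + Real.sqrt (Real.exp (θ * ((p.1 : ℝ) - ne)) / 2) * v p.2 p.1 t := by
    intro p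
    simp only [Pi.add_apply]
    ring
  simp_rw [e]
  exact sqrt_sum_sq_add_le _ _ _

/-- Squares of square roots: `V ≤ (√V₁ + √V₂)²` whenever `√V ≤ √V₁' + √V₂'` with `V₁' ≤ V₁`, `V₂' ≤ V₂` and `V ≥ 0`.
[folklore] -/
theorem le_sq_sqrt_add_of_sqrt_le {V V₁' V₂' V₁ V₂ : ℝ} (hV : 0 ≤ V)
    (h : Real.sqrt V ≤ Real.sqrt V₁' + Real.sqrt V₂') (h₁ : V₁' ≤ V₁) (h₂ : V₂' ≤ V₂) :
    V ≤ (Real.sqrt V₁ + Real.sqrt V₂) ^ 2 := by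
  have hs : Real.sqrt V ≤ Real.sqrt V₁ + Real.sqrt V₂ :=
    h.trans (add_le_add (Real.sqrt_le_sqrt h₁) (Real.sqrt_le_sqrt h₂))
  have h0 : 0 ≤ Real.sqrt V := Real.sqrt_nonneg _
  calc V = Real.sqrt V ^ 2 := (Real.sq_sqrt hV).symm
    _ ≤ (Real.sqrt V₁ + Real.sqrt V₂) ^ 2 := pow_le_pow_left₀ h0 hs 2

/-! ## Landing: the near clause of `H(n+1)` from two block energies at the landing time -/

section Landing

variable (P : TubeSchedule) {i₀ : Fin 2} {ustar : Fin 2 → ℤ → ℝ} {S W : Fin 2 → ℤ → ℝ → ℝ} {τ₁ a : ℝ}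

/-- **NEAR LANDING FROM ENERGIES.** If at the landing time `τ₁` the co-moving deviation energy of `S − W` on the
landing block `[1−D, −K]` (edge `1−K`) is `≤ V₁`, the reference flow lands within weighted energy `R_T` of the scaled
section state selected by the landing carrier (`x′ = |S i₀ 1 τ₁|/A_*`), and `(√V₁ + √R_T)² ≤ a²·v(n+1)`, then the
re-centred state satisfies the near clause of `H(n+1)`.
[cite: Tao2016AveragedNS, §6.3–6.4 (statement shape of the checkpoint step); route TaoLadderRungTwoFlat, `HopTube.TubeStepNear` (LADDER §49.5, §50.8)] -/
theorem near_landing_of_energies {V₁ RT : ℝ} {n : ℕ} (ha : 0 < a)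
    (hV : coMovingEnergyOn (Finset.Icc (1 - (P.D : ℤ)) (-(P.K : ℤ))) P.θV (1 - (P.K : ℝ)) (S - W) τ₁ ≤ V₁)
    (hR : ∑ k ∈ Finset.Icc (-(P.D : ℤ)) (-(P.K : ℤ) - 1), Real.exp (P.θV * ((k : ℝ) + P.K)) *
        ∑ i : Fin 2, (W i (1 + k) τ₁ - |S i₀ 1 τ₁| / P.Astar * ustar i k) ^ 2 / 2 ≤ RT)
    (hbudget : (Real.sqrt V₁ + Real.sqrt RT) ^ 2 ≤ a ^ 2 * P.v (n + 1)) :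
    NearClause P i₀ ustar (n + 1) (recentre S τ₁ a) := by
  refine nearClause_recentre P ha (le_trans ?_ hbudget)
  set x' : ℝ := |S i₀ 1 τ₁| / P.Astar with hx'
  set s : Finset ℤ := Finset.Icc (-(P.D : ℤ)) (-(P.K : ℤ) - 1) with hs
  -- the three families on the near block, read at the landing sites `1+k`
  set dev : Fin 2 → ℤ → ℝ → ℝ := fun i k t => S i (1 + k) t - x' * ustar i k with hdev
  set d₁ : Fin 2 → ℤ → ℝ → ℝ := fun i k t => S i (1 + k) t - W i (1 + k) t with hd₁
  set d₂ : Fin 2 → ℤ → ℝ → ℝ := fun i k t => W i (1 + k) t - x' * ustar i k with hd₂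
  have hsplit : dev = d₁ + d₂ := by
    funext i k t
    simp only [hdev, hd₁, hd₂, Pi.add_apply]
    ring
  -- the target sum is the block energy of `dev`
  have hLHS : (∑ k ∈ s, Real.exp (P.θV * ((k : ℝ) + P.K)) *
      ∑ i : Fin 2, (S i (1 + k) τ₁ - x' * ustar i k) ^ 2 / 2) = coMovingEnergyOn s P.θV (-(P.K : ℝ)) dev τ₁ := by
    rw [coMovingEnergyOn_eq_nearSum]
  -- the `d₁` energy is the landing-block energy of `S − W` (shift by one shell)
  have hd₁E : coMovingEnergyOn s P.θV (-(P.K : ℝ)) d₁ τ₁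
      = coMovingEnergyOn (Finset.Icc (1 - (P.D : ℤ)) (-(P.K : ℤ))) P.θV (1 - (P.K : ℝ)) (S - W) τ₁ := by
    have e1 : Finset.Icc (1 - (P.D : ℤ)) (-(P.K : ℤ)) = Finset.Icc (-(P.D : ℤ) + 1) (-(P.K : ℤ) - 1 + 1) := by
      congr 1 <;> ring
    have e2 : (1 - (P.K : ℝ)) = -(P.K : ℝ) + ((1 : ℤ) : ℝ) := by push_cast; ring
    rw [e1, e2, coMovingEnergyOn_Icc_shift]
    refine coMovingEnergyOn_congr_at fun i k _ => ?_
    simp only [hd₁, Pi.sub_apply, add_comm (1 : ℤ) k]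
  -- the `d₂` energy is the template landing residual
  have hd₂E : coMovingEnergyOn s P.θV (-(P.K : ℝ)) d₂ τ₁ ≤ RT := by
    rw [coMovingEnergyOn_eq_nearSum]
    exact hR
  have hmink := sqrt_coMovingEnergyOn_add_le s P.θV (-(P.K : ℝ)) d₁ d₂ τ₁
  rw [← hsplit, hd₁E] at hmink
  rw [hLHS]
  exact le_sq_sqrt_add_of_sqrt_le (coMovingEnergyOn_nonneg _ _ _ _ _) hmink hV hd₂E

end Landing

/-! ## The hop: decay along the two exact flows, then landing -/

section Hop

variable (P : TubeSchedule) {ε ε₀ τ κ₂ κ₂' : ℝ} {i₀ : Fin 2} {ustar : Fin 2 → ℤ → ℝ}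
  {W₀ FW₀ BW₀ S₀ FS₀ BS₀ : Fin 2 → ℤ → ℝ} {W FW S FS : Fin 2 → ℤ → ℝ → ℝ}

/-- Behind the window bottom every clock is at most `1` (`k ≤ −K ≤ 0`, `ε₀ ≥ 0`).
[cite: Tao2016AveragedNS, §4 (4.1) (the `(1+ε₀)^{5n/2}` scaling); route TaoLadderRungTwoFlat, L8b-1 (block clocks `c̄ = 1`)] -/
theorem clock_le_one_of_nonpos {ε₀ : ℝ} (hε₀ : 0 ≤ ε₀) {m : ℤ} (hm : m ≤ 0) : clock ε₀ m ≤ 1 := by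
  have h := clock_mono hε₀ hm
  have h0 : clock ε₀ 0 = 1 := by unfold clock; simp
  rwa [h0] at h

/-- **THE NEAR-ZONE HOP ALONG TWO EXACT GRADED WINDOW FLOWS.** Hop flow `S` and reference flow `W`, both exact
`PseudoFlowOnShift S♭ τ ε₀ T♭(ε) 0 …` on the certificate window; landing time `0 < τ₁ ≤ τ`, ratio `a > 0`; the co-moving
edge `n_e(t) = −K + σt` advances one shell over the hop (`στ₁ = 1`). Under the a-priori amplitude bound `A` on the
deviation and `M` on the reference (shells `[−D, 1−K]`, open hop interval), the edge-input bound `Ē` (bottom edge `−D`,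
top edge `−K`, in the co-moving weights), a rate `0 < μ ≤ σθ_V − 2(1+ε)(A sinh(θ_V/2) + M(3 + e^{θ_V}))`, an initial bound
`V_{[1−D,−K]}^{−K}(S − W)(0) ≤ V₀`, the template landing residual `R_T` and the budget
`(√(e^{−μτ₁}V₀ + Ē(1 − e^{−μτ₁})/μ) + √R_T)² ≤ a²·v(n+1)`, the re-centred landing state satisfies the near clause of
`H(n+1)`. (The inputs not proved here are exactly the named hypotheses `hA`, `hM`, `hE`, `hV₀`, `hR`.)
[cite: Tao2016AveragedNS, §4 (4.3), (4.8), §6.3–6.4 (statement shape of the checkpoint step); route TaoLadderRungTwoFlat, L8b-1 ⇒ `HopTube.TubeStepNear` (LADDER §49.3, §49.6, §50.8)] -/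
theorem near_hop_of_pseudoFlows
    (hW : PseudoFlowOnShift shiftSetFlat τ ε₀ (mirrorTable ε ε) 0 κ₂ W₀ FW₀ BW₀ W FW)
    (hS : PseudoFlowOnShift shiftSetFlat τ ε₀ (mirrorTable ε ε) 0 κ₂' S₀ FS₀ BS₀ S FS)
    (hε : 0 ≤ ε) (hε₀ : 0 ≤ ε₀) (hθ : 0 ≤ P.θV) (hDK : P.K + 1 ≤ P.D)
    {τ₁ σ a A M μ Ebar V₀ RT : ℝ} {n : ℕ} (hτ₁ : 0 < τ₁) (hτ₁τ : τ₁ ≤ τ) (hστ : σ * τ₁ = 1) (ha : 0 < a)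
    (hA : ∀ t ∈ Ioo 0 τ₁, ∀ i, ∀ m ∈ Finset.Icc (-(P.D : ℤ)) (1 - (P.K : ℤ)), |(S - W) i m t| ≤ A)
    (hM : ∀ t ∈ Ioo 0 τ₁, ∀ i, ∀ m ∈ Finset.Icc (-(P.D : ℤ)) (1 - (P.K : ℤ)), |W i m t| ≤ M)
    (hE : ∀ t ∈ Ioo 0 τ₁,
      Real.exp (P.θV * (((1 - (P.D : ℤ) : ℤ) : ℝ) - (-(P.K : ℝ) + σ * t))) * |fluxT ε ε₀ (S - W) (1 - (P.D : ℤ) - 1) t|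
        + Real.exp (P.θV * (((-(P.K : ℤ) : ℤ) : ℝ) - (-(P.K : ℝ) + σ * t))) * |fluxT ε ε₀ (S - W) (-(P.K : ℤ)) t|
        + (1 + ε) * 1 * M *
          (Real.exp (P.θV * (((1 - (P.D : ℤ) : ℤ) : ℝ) - (-(P.K : ℝ) + σ * t))) * (S - W) 1 (1 - (P.D : ℤ) - 1) t ^ 2
            + Real.exp (P.θV * (((-(P.K : ℤ) : ℤ) : ℝ) - (-(P.K : ℝ) + σ * t))) * (S - W) 0 (-(P.K : ℤ) + 1) t ^ 2)
        ≤ Ebar)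
    (hμ : 0 < μ)
    (hμle : μ ≤ σ * P.θV - 2 * (1 + ε) * 1 * (A * Real.sinh (P.θV / 2) + M * (3 + Real.exp P.θV)))
    (hV₀ : coMovingEnergyOn (Finset.Icc (1 - (P.D : ℤ)) (-(P.K : ℤ))) P.θV (-(P.K : ℝ)) (S - W) 0 ≤ V₀)
    (hR : ∑ k ∈ Finset.Icc (-(P.D : ℤ)) (-(P.K : ℤ) - 1), Real.exp (P.θV * ((k : ℝ) + P.K)) *
        ∑ i : Fin 2, (W i (1 + k) τ₁ - |S i₀ 1 τ₁| / P.Astar * ustar i k) ^ 2 / 2 ≤ RT)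
    (hbudget : (Real.sqrt (Real.exp (-μ * τ₁) * V₀ + Ebar * (1 - Real.exp (-μ * τ₁)) / μ) + Real.sqrt RT) ^ 2
      ≤ a ^ 2 * P.v (n + 1)) :
    NearClause P i₀ ustar (n + 1) (recentre S τ₁ a) := by
  have haP : (1 - (P.D : ℤ)) ≤ -(P.K : ℤ) := by
    have : ((P.K + 1 : ℕ) : ℤ) ≤ (P.D : ℤ) := by exact_mod_cast hDK
    push_cast at this; omega
  -- the a-priori bounds on the decay lemma's shell ranges
  have hA' : ∀ t ∈ Ioo 0 τ₁, ∀ i, ∀ m ∈ Finset.Icc (1 - (P.D : ℤ) - 1) (-(P.K : ℤ) + 1), |(S - W) i m t| ≤ A := by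
    intro t ht i m hm
    refine hA t ht i m ?_
    simp only [Finset.mem_Icc] at hm ⊢; omega
  have hM' : ∀ t ∈ Ioo 0 τ₁, ∀ i, ∀ m ∈ Finset.Icc (1 - (P.D : ℤ) - 1) (-(P.K : ℤ) + 1), |W i m t| ≤ M := by
    intro t ht i m hm
    refine hM t ht i m ?_
    simp only [Finset.mem_Icc] at hm ⊢; omega
  have hc' : ∀ m ∈ Finset.Icc (1 - (P.D : ℤ) - 1) (-(P.K : ℤ)), clock ε₀ m ≤ 1 := by
    intro m hm
    simp only [Finset.mem_Icc] at hm
    exact clock_le_one_of_nonpos hε₀ (by omega)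
  have hdecay := coMovingEnergyOn_decay_of_pseudoFlows (n₀ := -(P.K : ℝ)) (σ := σ) (θ := P.θV) hW hS hε
    (by linarith) hθ haP le_rfl hτ₁.le hτ₁τ hA' hM' hc' hE hμ hμle
  -- edge positions: `n_e(τ₁) = 1 − K`, `n_e(0) = −K`
  have e1 : -(P.K : ℝ) + σ * τ₁ = 1 - (P.K : ℝ) := by linarith
  have e0 : -(P.K : ℝ) + σ * 0 = -(P.K : ℝ) := by ring
  rw [e1, e0, sub_zero] at hdecay
  have hexp0 : 0 ≤ Real.exp (-μ * τ₁) := (Real.exp_pos _).le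
  have hV₁ : coMovingEnergyOn (Finset.Icc (1 - (P.D : ℤ)) (-(P.K : ℤ))) P.θV (1 - (P.K : ℝ)) (S - W) τ₁
      ≤ Real.exp (-μ * τ₁) * V₀ + Ebar * (1 - Real.exp (-μ * τ₁)) / μ :=
    hdecay.trans (by nlinarith [mul_le_mul_of_nonneg_left hV₀ hexp0])
  exact near_landing_of_energies P ha hV₁ hR hbudget

end Hop

/-! ## The flat twin (`ε₀ = 0`, two global solutions: child 1A's flat tube) and the template landing residual -/

section Flat

variable (P : TubeSchedule) {ε : ℝ} {i₀ : Fin 2} {ustar : Fin 2 → ℤ → ℝ} {W S : Fin 2 → ℤ → ℝ → ℝ}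

/-- **THE NEAR-ZONE HOP ALONG TWO GLOBAL FLAT SOLUTIONS** (`ε₀ = 0`: the hop flow `S` is the datum solution itself, the
reference `W` a pulse-family member; no certificate window, any kick including none). Same statement and proof as
`near_hop_of_pseudoFlows` with the tree's flat decay lemma `MirrorPulse.coMovingEnergyOn_decay_of_globalSol`.
[cite: Tao2016AveragedNS, §4 (4.3), (4.8), §6.3–6.4 (statement shape); route TaoLadderRungTwoFlat, L8b-1 at `λ₀ = 1` ⇒ `HopTube.TubeStepNear` for the flat tube (child 1A's clause (WG); LADDER §49, §52.4 A52-1)] -/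
theorem near_hop_of_globalSols (hW : IsGlobalSol ε W) (hS : IsGlobalSol ε S)
    (hε : 0 ≤ ε) (hθ : 0 ≤ P.θV) (hDK : P.K + 1 ≤ P.D)
    {τ₁ σ a A M μ Ebar V₀ RT : ℝ} {n : ℕ} (hτ₁ : 0 < τ₁) (hστ : σ * τ₁ = 1) (ha : 0 < a)
    (hA : ∀ t ∈ Ioo 0 τ₁, ∀ i, ∀ m ∈ Finset.Icc (-(P.D : ℤ)) (1 - (P.K : ℤ)), |(S - W) i m t| ≤ A)
    (hM : ∀ t ∈ Ioo 0 τ₁, ∀ i, ∀ m ∈ Finset.Icc (-(P.D : ℤ)) (1 - (P.K : ℤ)), |W i m t| ≤ M)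
    (hE : ∀ t ∈ Ioo 0 τ₁,
      Real.exp (P.θV * (((1 - (P.D : ℤ) : ℤ) : ℝ) - (-(P.K : ℝ) + σ * t))) * |fluxT ε 0 (S - W) (1 - (P.D : ℤ) - 1) t|
        + Real.exp (P.θV * (((-(P.K : ℤ) : ℤ) : ℝ) - (-(P.K : ℝ) + σ * t))) * |fluxT ε 0 (S - W) (-(P.K : ℤ)) t|
        + (1 + ε) * 1 * M *
          (Real.exp (P.θV * (((1 - (P.D : ℤ) : ℤ) : ℝ) - (-(P.K : ℝ) + σ * t))) * (S - W) 1 (1 - (P.D : ℤ) - 1) t ^ 2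
            + Real.exp (P.θV * (((-(P.K : ℤ) : ℤ) : ℝ) - (-(P.K : ℝ) + σ * t))) * (S - W) 0 (-(P.K : ℤ) + 1) t ^ 2)
        ≤ Ebar)
    (hμ : 0 < μ)
    (hμle : μ ≤ σ * P.θV - 2 * (1 + ε) * 1 * (A * Real.sinh (P.θV / 2) + M * (3 + Real.exp P.θV)))
    (hV₀ : coMovingEnergyOn (Finset.Icc (1 - (P.D : ℤ)) (-(P.K : ℤ))) P.θV (-(P.K : ℝ)) (S - W) 0 ≤ V₀)
    (hR : ∑ k ∈ Finset.Icc (-(P.D : ℤ)) (-(P.K : ℤ) - 1), Real.exp (P.θV * ((k : ℝ) + P.K)) *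
        ∑ i : Fin 2, (W i (1 + k) τ₁ - |S i₀ 1 τ₁| / P.Astar * ustar i k) ^ 2 / 2 ≤ RT)
    (hbudget : (Real.sqrt (Real.exp (-μ * τ₁) * V₀ + Ebar * (1 - Real.exp (-μ * τ₁)) / μ) + Real.sqrt RT) ^ 2
      ≤ a ^ 2 * P.v (n + 1)) :
    NearClause P i₀ ustar (n + 1) (recentre S τ₁ a) := by
  have haP : (1 - (P.D : ℤ)) ≤ -(P.K : ℤ) := by
    have : ((P.K + 1 : ℕ) : ℤ) ≤ (P.D : ℤ) := by exact_mod_cast hDK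
    push_cast at this; omega
  have hA' : ∀ t ∈ Ioo 0 τ₁, ∀ i, ∀ m ∈ Finset.Icc (1 - (P.D : ℤ) - 1) (-(P.K : ℤ) + 1), |(S - W) i m t| ≤ A := by
    intro t ht i m hm
    refine hA t ht i m ?_
    simp only [Finset.mem_Icc] at hm ⊢; omega
  have hM' : ∀ t ∈ Ioo 0 τ₁, ∀ i, ∀ m ∈ Finset.Icc (1 - (P.D : ℤ) - 1) (-(P.K : ℤ) + 1), |W i m t| ≤ M := by
    intro t ht i m hm
    refine hM t ht i m ?_
    simp only [Finset.mem_Icc] at hm ⊢; omega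
  have hdecay := coMovingEnergyOn_decay_of_globalSol (n₀ := -(P.K : ℝ)) (σ := σ) (θ := P.θV) hε hθ haP hτ₁.le
    hW hS hA' hM' hE hμ hμle
  have e1 : -(P.K : ℝ) + σ * τ₁ = 1 - (P.K : ℝ) := by linarith
  have e0 : -(P.K : ℝ) + σ * 0 = -(P.K : ℝ) := by ring
  rw [e1, e0, sub_zero] at hdecay
  have hexp0 : 0 ≤ Real.exp (-μ * τ₁) := (Real.exp_pos _).le
  have hV₁ : coMovingEnergyOn (Finset.Icc (1 - (P.D : ℤ)) (-(P.K : ℤ))) P.θV (1 - (P.K : ℝ)) (S - W) τ₁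
      ≤ Real.exp (-μ * τ₁) * V₀ + Ebar * (1 - Real.exp (-μ * τ₁)) / μ :=
    hdecay.trans (by nlinarith [mul_le_mul_of_nonneg_left hV₀ hexp0])
  exact near_landing_of_energies P ha hV₁ hR hbudget

/-- **TEMPLATE LANDING RESIDUAL OF AN EXACT SHIFT LANDING.** If the reference flow lands EXACTLY on the scale-`x` section
state one shell up (`W(1+k, τ₁) = x·u⋆(k)` on the near block — a shift-periodic pulse member after one period at its
own clock), the template landing residual against the carrier-selected member `x′·u⋆` is `(x − x′)²` times the weighted
block energy of `u⋆`: the near loop's entry fed by the anchor-scale drift over the hop (a CORE-zone output).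
[cite: Tao2016AveragedNS, §5–§6 (self-similar ansatz, statement shape); route TaoLadderRungTwoFlat, `HopTube.TubeStepNear` entry `m₁₂` (LADDER §49.5, §50.8)] -/
theorem templateResidual_of_shift_landing {τ₁ x x' : ℝ}
    (hland : ∀ i, ∀ k ∈ Finset.Icc (-(P.D : ℤ)) (-(P.K : ℤ) - 1), W i (1 + k) τ₁ = x * ustar i k) :
    ∑ k ∈ Finset.Icc (-(P.D : ℤ)) (-(P.K : ℤ) - 1), Real.exp (P.θV * ((k : ℝ) + P.K)) *
        ∑ i : Fin 2, (W i (1 + k) τ₁ - x' * ustar i k) ^ 2 / 2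
      = (x - x') ^ 2 * ∑ k ∈ Finset.Icc (-(P.D : ℤ)) (-(P.K : ℤ) - 1), Real.exp (P.θV * ((k : ℝ) + P.K)) *
        ∑ i : Fin 2, ustar i k ^ 2 / 2 := by
  rw [Finset.mul_sum]
  refine Finset.sum_congr rfl fun k hk => ?_
  rw [Fin.sum_univ_two, Fin.sum_univ_two, hland 0 k hk, hland 1 k hk]
  ring

end Flat

end Summit.NavierStokesRegularity.NavierStokesRegularity.Theorems.HopTube

end
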